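import Literature.AnabelianGeometry.AbsoluteAnabelian.AbsTopIII.KummerFaithfulSubpadicProofs
import Literature.AlgebraicGeometry.Motives.AbelianVarietyBaseChange
import Literature.NumberTheory.DiophantineGeometry.AVGaloisModule
import Mathlib.Algebra.Field.ULift
import HarnessLib

/-!
# [AbsTopIII] Rmk. 1.5.4 (i), the base-change step: Kummer-faithfulness descends along field embeddings

Proof-only companion (no new definitions) to `AbsTopIII/KummerFaithful.lean` (S. Mochizuki,
*Topics in Absolute Anabelian Geometry III*, §1, Def. 1.5 p. 32 and Rmk. 1.5.4 (i) p. 33, lit key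
`paper:url-5493eb38cbb7`).  Rmk. 1.5.4 (i) reads: "every sub-`p`-adic field `k` [...] is
Kummer-faithful [...]. Indeed, to verify this, one reduces immediately, by base-change, to the case
where `k` is a finitely generated extension of an MLF [...]. Then by restricting to various closed
points of this variety, one reduces to the case where `k` itself is an MLF."

What is kernel-checked here is the FIRST of these two reductions ("by base-change"), for the FULL
tree predicate `IsKummerFaithful` (torus clause AND abelian-variety clause), as an unconditional
theorem about arbitrary fields:

* `IsKummerFaithful.of_ringHom` : if `k` embeds into a Kummer-faithful field `L` (any field
  homomorphism `k →+* L`, same universe), then `k` is Kummer-faithful.  Mechanism, exactly as in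
  print: a finite extension `k'` of `k` embeds into a finite extension `L'` of `L`
  (`exists_finite_extension_of_ringHom`); an abelian variety `A / k'` base-changes to
  `A_{L'} / L'` (`AbelianVariety.baseChange`, tree `Motives/AbelianVarietyProjective`); the group
  `A(k')` embeds into `A(L') ≃ A_{L'}(L')` (`AlgPoints.extendScalars_injective`,
  `AbelianVariety.pointsMulEquiv`, tree `DiophantineGeometry/AVGaloisModule`,
  `Motives/AbelianVarietyBaseChange`); and condition (a) of Def. 1.5 ("`⋂_N N · A(k') = {0}`")
  passes to subgroups (`DivisibleElementsTrivial.of_injective_monoidHom`).  The torus clause is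
  `IsTorallyKummerFaithful.of_ringHom` (units embed into units).
* Corollaries: `IsKummerFaithful.of_algebra`, `.intermediateField`, `.subfield`;
  `IsKummerFaithful.of_ringHom_padic` (a field embeddable in `ℚ_p` — e.g. `ℚ`, or a number field
  with a prime of residue degree one over `p` — is Kummer-faithful as soon as `ℚ_p` is), and
  `isKummerFaithful_rat_of_padic`.
* `Rmk_1_5_4_i_of_abelianVariety_clause_fg` : the named fact `Rmk_1_5_4_i` (FACT-LIST row F-0369,
  "sub-`p`-adic ⟹ Kummer-faithful") follows from condition (a) of Def. 1.5 for abelian varieties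
  over fields FINITELY GENERATED over some `ℚ_p` ONLY — one layer of quantifiers instead of the two
  ("every finite extension of every sub-`p`-adic field") of `Rmk_1_5_4_i_of_abelianVariety_clause`
  (companion `KummerFaithfulSubpadicProofs`); at universe `0` the two are EQUIVALENT
  (`rmk_1_5_4_i_iff_abelianVariety_clause_fg`), so no strength is lost.

HONEST FRAMING: nothing here proves F-0369 — no Kummer-faithful field is constructed; the residual
named input is now "`⋂_N N · A(L) = {0}` for every abelian variety `A` over every finitely generated
extension `L` of `ℚ_p`" (in print: the closed-point specialisation step plus the MLF case, i.e.
"`A(k)` is an extension of a finitely generated `ℤ`-module by a compact abelian `p`-adic Lie group",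
p. 33 — Mattuck 1955), which is NOT proved here and NOT asserted.  For the MLF instances the cone
consumes (`ℚ`, `ℚ_2`, `ℚ_p`) the residual is the MLF case alone (`IsKummerFaithful.of_ringHom_padic`);
the sibling companion `KummerFaithfulProfiniteProofs` reduces that case further to the profiniteness of
`A(K)`.  Classical facts about fields and group schemes; nothing here bears on [IUTchIII] Cor. 3.12;
typed ≠ discharged.
-/

noncomputable section

open scoped Classical

namespace Literature.AnabelianGeometry.AbsoluteAnabelian.AbsTopIII

universe u

open Literature.AlgebraicGeometry.Motives

/-! ### Condition (a) of Def. 1.5 passes to subgroups -/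

/-- Condition (a) of [AbsTopIII] Def. 1.5 p. 32 ("`⋂_{N ≥ 1} N · A = {0}`") passes to subgroups: if
`G` embeds in `H` by a group homomorphism and `H` has no nontrivial infinitely divisible element, then
neither has `G` (an `N`-th root in `G` maps to an `N`-th root in `H`).
[cite: MochizukiAbsTopIII2015, Def 1.5 (a) p.32] -/
theorem DivisibleElementsTrivial.of_injective_monoidHom {G H : Type*} [CommGroup G] [CommGroup H]
    (f : G →* H) (hf : Function.Injective f) (h : DivisibleElementsTrivial H) :
    DivisibleElementsTrivial G := by
  refine ⟨fun x hx => hf ?_⟩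
  rw [map_one]
  refine h.eq_one_of_forall_exists_pow (f x) fun n hn => ?_
  obtain ⟨y, hy⟩ := hx n hn
  exact ⟨f y, by rw [← map_pow, hy]⟩

/-! ### Finite extensions follow field embeddings -/

/-- "By base-change" (Rmk. 1.5.4 (i) p. 33), the field-theoretic step: if `k` embeds into `L` and
`F ⊇ k` is a finite extension, then `F` embeds into a finite extension `L'` of `L` (namely the
subfield of an algebraic closure of `L` generated over `L` by the image of a `k`-basis of `F` under a
lift `F → L̄` of `k → L → L̄`).  All fields in one universe, as needed for base change of schemes.
[cite: MochizukiAbsTopIII2015, Rmk 1.5.4 (i) p.33] -/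
theorem exists_finite_extension_of_ringHom {k L : Type u} [Field k] [Field L] (ι : k →+* L)
    (F : Type u) [Field F] [Algebra k F] [Module.Finite k F] :
    ∃ (L' : Type u) (_ : Field L') (_ : Algebra L L'), Module.Finite L L' ∧ Nonempty (F →+* L') := by
  -- work inside an algebraic closure `Ω` of `L`
  let Ω : Type u := AlgebraicClosure L
  let φ : k →+* Ω := (algebraMap L Ω).comp ι
  letI : Algebra k Ω := φ.toAlgebra
  haveI : Algebra.IsAlgebraic k F := Algebra.IsAlgebraic.of_finite k F
  -- lift the embedding of `k` to `F`
  let ψ : F →ₐ[k] Ω := IsAlgClosed.lift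
  -- `L' := L(ψ(F))`, generated over `L` by the images of a `k`-basis of `F`
  classical
  let b := Module.Free.chooseBasis k F
  let s : Finset Ω := (Finset.univ : Finset (Module.Free.ChooseBasisIndex k F)).image
    fun i => ψ (b i)
  let L' : IntermediateField L Ω := IntermediateField.adjoin L (s : Set Ω)
  have hψ : ∀ x : F, (ψ x : Ω) ∈ L' := by
    intro x
    rw [← b.sum_repr x, map_sum]
    refine sum_mem fun i _ => ?_
    rw [map_smul, Algebra.smul_def]
    refine mul_mem ?_ (IntermediateField.subset_adjoin L _ ?_)
    · -- scalars from `k` land in `L ⊆ L'`: `algebraMap k Ω = (algebraMap L Ω) ∘ ι`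
      exact L'.algebraMap_mem (ι (b.repr x i))
    · simp [s]
  -- `L'/L` is finite
  haveI hfin : FiniteDimensional L L' := by
    refine IntermediateField.finiteDimensional_adjoin (S := (s : Set Ω)) fun x _ => ?_
    exact Algebra.IsIntegral.isIntegral x
  exact ⟨L', inferInstance, inferInstance, hfin, ⟨(ψ : F →+* Ω).codRestrict L' hψ⟩⟩

/-! ### The torus clause descends along field embeddings -/

/-- The torus clause of Def. 1.5 descends along field embeddings: if `k` embeds into a torally
Kummer-faithful field `L`, then `k` is torally Kummer-faithful — a finite extension `k'` of `k`
embeds into a finite extension `L'` of `L`, and `⋂_N (k'^×)^N ↪ ⋂_N (L'^×)^N = {1}` ("by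
base-change", Rmk. 1.5.4 (i) p. 33; cf. `IsTorallyKummerFaithful.of_embedding_into_fg`, which
descends from a base in universe `0` through a finitely generated extension).
[cite: MochizukiAbsTopIII2015, Rmk 1.5.4 (i) p.33] -/
theorem IsTorallyKummerFaithful.of_ringHom {k L : Type u} [Field k] [Field L] (ι : k →+* L)
    (hL : IsTorallyKummerFaithful L) : IsTorallyKummerFaithful k := by
  haveI : CharZero L := hL.charZero
  haveI : CharZero k := ι.charZero
  refine ⟨inferInstance, fun k' _ _ hfin => ?_⟩
  haveI := hfin
  obtain ⟨L', _, _, hfinL, ⟨g⟩⟩ := exists_finite_extension_of_ringHom ι k'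
  exact DivisibleElementsTrivial.of_injective_monoidHom (Units.map (g : k' →* L'))
    (Units.map_injective g.injective) (hL.units L' hfinL)

/-! ### The abelian-variety clause descends along field embeddings -/

section AbelianVarietyClause

/-- For an abelian variety `A` over `k'` and a field extension `L' ⊇ k'`: if `A_{L'}(L')` has no
nontrivial infinitely divisible element, neither has `A(k')` — the group `A(k')` embeds into
`A(L')` (extension of scalars of points is an injective homomorphism, `Spec L' → Spec k'` being an
epimorphism: tree `AlgPoints.extendScalarsMonoidHom`, `AlgPoints.extendScalars_injective`), and
`A(L') ≃ A_{L'}(L')` as groups (tree `AbelianVariety.pointsMulEquiv`).  This is condition (a) of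
Def. 1.5 p. 32 "by base-change" (Rmk. 1.5.4 (i) p. 33) for ONE abelian variety.
[cite: MochizukiAbsTopIII2015, Rmk 1.5.4 (i) p.33] -/
theorem divisibleElementsTrivial_points_of_baseChange {k' L' : Type u} [Field k'] [Field L']
    [Algebra k' L'] (A : AbelianVariety k')
    (h : DivisibleElementsTrivial ((A.baseChange L').Points L')) :
    DivisibleElementsTrivial (A.Points k') := by
  have hL' : DivisibleElementsTrivial (A.Points L') :=
    DivisibleElementsTrivial.of_injective_monoidHom (A.pointsMulEquiv L').toMonoidHom
      (A.pointsMulEquiv L').injective h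
  exact DivisibleElementsTrivial.of_injective_monoidHom
    (AlgPoints.extendScalarsMonoidHom A.X k' L') (AlgPoints.extendScalars_injective A.X k' L') hL'

/-- **The abelian-variety clause of Def. 1.5 descends along field embeddings** ("by base-change",
Rmk. 1.5.4 (i) p. 33): if `k` embeds into a field `L` all of whose finite extensions `L'` satisfy
condition (a) of Def. 1.5 for every abelian variety over `L'`, then every finite extension `k'` of `k`
satisfies condition (a) for every abelian variety over `k'` — `k'` embeds into a finite extension
`L'` of `L` (`exists_finite_extension_of_ringHom`) and `A(k') ↪ A_{L'}(L')`
(`divisibleElementsTrivial_points_of_baseChange`). [cite: MochizukiAbsTopIII2015, Rmk 1.5.4 (i) p.33] -/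
theorem abelianVariety_clause_of_ringHom {k L : Type u} [Field k] [Field L] (ι : k →+* L)
    (hL : ∀ (L' : Type u) [Field L'] [Algebra L L'], Module.Finite L L' →
      ∀ B : AbelianVariety L', DivisibleElementsTrivial (B.Points L')) :
    ∀ (k' : Type u) [Field k'] [Algebra k k'], Module.Finite k k' →
      ∀ A : AbelianVariety k', DivisibleElementsTrivial (A.Points k') := by
  intro k' _ _ hfin A
  haveI := hfin
  obtain ⟨L', _, _, hfinL, ⟨g⟩⟩ := exists_finite_extension_of_ringHom ι k'
  letI : Algebra k' L' := g.toAlgebra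
  exact divisibleElementsTrivial_points_of_baseChange A (hL L' hfinL (A.baseChange L'))

end AbelianVarietyClause

/-! ### Kummer-faithfulness descends along field embeddings -/

/-- **Kummer-faithfulness descends along field embeddings** ([AbsTopIII] Rmk. 1.5.4 (i) p. 33, "one
reduces immediately, by base-change"): if `k` embeds into a Kummer-faithful field `L` (tree predicate
`IsKummerFaithful`: torus clause and abelian-variety clause of Def. 1.5 p. 32), then `k` is
Kummer-faithful.  Unconditional; no Kummer-faithful field is constructed here.
[cite: MochizukiAbsTopIII2015, Rmk 1.5.4 (i) p.33] -/
theorem IsKummerFaithful.of_ringHom {k L : Type u} [Field k] [Field L] (ι : k →+* L)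
    (hL : IsKummerFaithful L) : IsKummerFaithful k :=
  ⟨hL.torally.of_ringHom ι, abelianVariety_clause_of_ringHom ι hL.abelianVariety⟩

/-- A subfield (given as an algebra structure `k → L`) of a Kummer-faithful field is Kummer-faithful
(Rmk. 1.5.4 (i) p. 33, base-change step). [cite: MochizukiAbsTopIII2015, Rmk 1.5.4 (i) p.33] -/
theorem IsKummerFaithful.of_algebra (k L : Type u) [Field k] [Field L] [Algebra k L]
    (hL : IsKummerFaithful L) : IsKummerFaithful k :=
  hL.of_ringHom (algebraMap k L)

/-- An intermediate field of `L ⊇ k` with `L` Kummer-faithful is Kummer-faithful (Rmk. 1.5.4 (i)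
p. 33, base-change step). [cite: MochizukiAbsTopIII2015, Rmk 1.5.4 (i) p.33] -/
theorem IsKummerFaithful.intermediateField {k L : Type u} [Field k] [Field L] [Algebra k L]
    (hL : IsKummerFaithful L) (E : IntermediateField k L) : IsKummerFaithful E :=
  hL.of_ringHom (algebraMap E L)

/-- A subfield of a Kummer-faithful field is Kummer-faithful (Rmk. 1.5.4 (i) p. 33, base-change
step). [cite: MochizukiAbsTopIII2015, Rmk 1.5.4 (i) p.33] -/
theorem IsKummerFaithful.subfield {L : Type u} [Field L] (hL : IsKummerFaithful L)
    (S : Subfield L) : IsKummerFaithful S :=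
  hL.of_ringHom S.subtype

/-! ### The MLF instances: fields embeddable in `ℚ_p` -/

/-- A field that embeds into `ℚ_p` (e.g. `ℚ`, or a number field with a prime of residue degree one
and ramification index one over `p`) is Kummer-faithful as soon as `ℚ_p` is — the case "`k` itself is
an MLF" of Rmk. 1.5.4 (i) p. 33 is the only input.  (`IsKummerFaithful ℚ_[p]` is NOT proved in the
tree: its abelian-variety clause is Mattuck's theorem; the companion `KummerFaithfulProfiniteProofs`
reduces it to the profiniteness of `A(K)`.) [cite: MochizukiAbsTopIII2015, Rmk 1.5.4 (i) p.33] -/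
theorem IsKummerFaithful.of_ringHom_padic {k : Type} [Field k] {p : ℕ} [Fact p.Prime]
    (ι : k →+* ℚ_[p]) (h : IsKummerFaithful ℚ_[p]) : IsKummerFaithful k :=
  h.of_ringHom ι

/-- `ℚ` is Kummer-faithful as soon as some `ℚ_p` is (Rmk. 1.5.4 (i) p. 33, base-change step; the
form in which the cone's instances "`ℚ` is Kummer-faithful modulo F-0369" can be fed from the MLF
case alone). [cite: MochizukiAbsTopIII2015, Rmk 1.5.4 (i) p.33] -/
theorem isKummerFaithful_rat_of_padic (p : ℕ) [Fact p.Prime] (h : IsKummerFaithful ℚ_[p]) :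
    IsKummerFaithful ℚ :=
  h.of_ringHom (algebraMap ℚ ℚ_[p])

/-- `ℚ_p` is Kummer-faithful as soon as condition (a) of Def. 1.5 holds for every abelian variety
over every finite extension `K` of `ℚ_p` (the MLF case of Rmk. 1.5.4 (i) p. 33: "`A(k)` is an
extension of a finitely generated `ℤ`-module by a compact abelian `p`-adic Lie group", i.e.
Mattuck's theorem — NOT proved here); the torus clause is `isTorallyKummerFaithful_padic`.
[cite: MochizukiAbsTopIII2015, Rmk 1.5.4 (i) p.33] -/
theorem isKummerFaithful_padic_of_abelianVariety_clause (p : ℕ) [Fact p.Prime]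
    (hAV : ∀ (K : Type) [Field K] [Algebra ℚ_[p] K], Module.Finite ℚ_[p] K →
      ∀ A : AbelianVariety K, DivisibleElementsTrivial (A.Points K)) :
    IsKummerFaithful ℚ_[p] :=
  ⟨isTorallyKummerFaithful_padic p, hAV⟩

/-! ### Remark 1.5.4 (i) reduced to finitely generated extensions of `ℚ_p` -/

/-- A finite extension `L'` of a field `L` essentially of finite type over `F` is essentially of
finite type over `F` (for the composite algebra structure `F → L → L'`); fields only.  Routine
(Mathlib `Algebra.EssFiniteType.comp`). [cite: MochizukiAbsTopIII2015, Rmk 1.5.4 (i) p.33] -/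
theorem fg_top_of_finite_extension {F L : Type*} (L' : Type*) [Field F] [Field L] [Field L']
    [Algebra F L] [Algebra L L'] [Algebra F L'] [IsScalarTower F L L'] [Module.Finite L L']
    (hL : (⊤ : IntermediateField F L).FG) : (⊤ : IntermediateField F L').FG := by
  haveI : Algebra.EssFiniteType F L := IntermediateField.fg_top_iff.mp hL
  haveI : Algebra.EssFiniteType L L' := inferInstance
  haveI : Algebra.EssFiniteType F L' := Algebra.EssFiniteType.comp F L L'
  exact IntermediateField.fg_top_iff.mpr inferInstance

/-- **[AbsTopIII] Rmk. 1.5.4 (i) reduced to finitely generated extensions of `ℚ_p`** ("one reduces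
immediately, by base-change, to the case where `k` is a finitely generated extension of an MLF",
p. 33): the named fact `Rmk_1_5_4_i` ("sub-`p`-adic ⟹ Kummer-faithful", FACT-LIST row F-0369)
follows from condition (a) of Def. 1.5 p. 32 for abelian varieties over fields finitely generated
over some `ℚ_p` — ONE layer of quantifiers (the hypothesis of `Rmk_1_5_4_i_of_abelianVariety_clause`
quantified over every finite extension of every sub-`p`-adic field).  The torus clause is the proved
`IsSubpadic.isTorallyKummerFaithful`; the abelian-variety clause is transported along the
sub-`p`-adic embedding `k ↪ L` (`abelianVariety_clause_of_ringHom`, with `L` lifted to the universe of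
`k`).  The residual hypothesis `hAV` — the closed-point specialisation step plus Mattuck's theorem
— is NOT proved here and NOT asserted. [cite: MochizukiAbsTopIII2015, Rmk 1.5.4 (i) p.33] -/
theorem Rmk_1_5_4_i_of_abelianVariety_clause_fg
    (hAV : ∀ (p : ℕ) [Fact p.Prime] (L : Type u) [Field L] [Algebra ℚ_[p] L],
      (⊤ : IntermediateField ℚ_[p] L).FG →
        ∀ A : AbelianVariety L, DivisibleElementsTrivial (A.Points L)) :
    Rmk_1_5_4_i.{u} := by
  intro k _ hk
  refine ⟨hk.isTorallyKummerFaithful, ?_⟩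
  obtain ⟨p, hp, hkp⟩ := hk.exists_prime
  obtain ⟨L₀, _, _, hFG, ⟨ι₀⟩⟩ := hkp.exists_embedding
  -- lift the finitely generated extension `L₀ / ℚ_p` (universe `0`) to the universe of `k`
  let L : Type u := ULift.{u} L₀
  let e : L ≃ₐ[ℚ_[p]] L₀ := ULift.algEquiv
  let ι : k →+* L := (e.symm : L₀ →ₐ[ℚ_[p]] L).toRingHom.comp ι₀
  haveI : Algebra.EssFiniteType ℚ_[p] L₀ := IntermediateField.fg_top_iff.mp hFG
  haveI : Algebra.EssFiniteType ℚ_[p] L :=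
    Algebra.EssFiniteType.of_surjective (e.symm : L₀ →ₐ[ℚ_[p]] L) e.symm.surjective
  have hL : (⊤ : IntermediateField ℚ_[p] L).FG := IntermediateField.fg_top_iff.mpr inferInstance
  refine abelianVariety_clause_of_ringHom ι fun L' _ _ hfin B => ?_
  haveI := hfin
  letI : Algebra ℚ_[p] L' := ((algebraMap L L').comp (algebraMap ℚ_[p] L)).toAlgebra
  haveI : IsScalarTower ℚ_[p] L L' := IsScalarTower.of_algebraMap_eq fun _ => rfl
  exact hAV p L' (fg_top_of_finite_extension L' hL) B

/-- Converse at universe `0` (no strength is lost): `Rmk_1_5_4_i` implies condition (a) of Def. 1.5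
for abelian varieties over fields finitely generated over `ℚ_p`, since such a field is sub-`p`-adic
(witnessed by itself). [cite: MochizukiAbsTopIII2015, Rmk 1.5.4 (i) p.33] -/
theorem abelianVariety_clause_fg_of_rmk_1_5_4_i (h : Rmk_1_5_4_i.{0}) :
    ∀ (p : ℕ) [Fact p.Prime] (L : Type) [Field L] [Algebra ℚ_[p] L],
      (⊤ : IntermediateField ℚ_[p] L).FG →
        ∀ A : AbelianVariety L, DivisibleElementsTrivial (A.Points L) := by
  intro p _ L _ _ hFG A
  have hsub : IsSubpadic L := ⟨⟨p, inferInstance, ⟨⟨L, inferInstance, inferInstance, hFG,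
    ⟨RingHom.id L⟩⟩⟩⟩⟩
  exact (h L hsub).abelianVariety L (Module.Finite.self L) A

/-- **F-0369 restated in one layer (universe `0`)**: `Rmk_1_5_4_i` ("every sub-`p`-adic field is
Kummer-faithful", [AbsTopIII] Rmk. 1.5.4 (i) p. 33, with the tree's `IsKummerFaithful`) is EQUIVALENT
to condition (a) of Def. 1.5 p. 32 for abelian varieties over fields finitely generated over some
`ℚ_p`.  Neither side is proved here. [cite: MochizukiAbsTopIII2015, Rmk 1.5.4 (i) p.33] -/
theorem rmk_1_5_4_i_iff_abelianVariety_clause_fg :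
    Rmk_1_5_4_i.{0} ↔
      ∀ (p : ℕ) [Fact p.Prime] (L : Type) [Field L] [Algebra ℚ_[p] L],
        (⊤ : IntermediateField ℚ_[p] L).FG →
          ∀ A : AbelianVariety L, DivisibleElementsTrivial (A.Points L) :=
  ⟨abelianVariety_clause_fg_of_rmk_1_5_4_i, fun h => Rmk_1_5_4_i_of_abelianVariety_clause_fg h⟩

end Literature.AnabelianGeometry.AbsoluteAnabelian.AbsTopIII
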